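import Summits.PneNP.PneNP.Theorems.CliqueExtLowerBound.Negative.LoadBearing
import Summits.PneNP.PneNP.Theorems.CliqueExtLowerBound.Negative.PermConsequences
import Summits.PneNP.PneNP.Theorems.CliqueExtLowerBound.Negative.UncertifiedRejection
import Literature.Computability.Complexity.RossmanMonotoneCliqueProb

/-!
# Line `convex-collapse-feature-rank` for the crux `CliqueExtLowerBound` (stmt-PneNP-10682)

Crux (route `ConvexRankGates`, rank 5):
`Summit.PneNP.PneNP.Theses.ConvexRankGates.CliqueExtLowerBound` —
`∃ δ ∈ (0,1/2), ∀ c, ∀ᶠ m, no circuit with ≤ m^c gates over B_{m^c} = {∧₂,∨₂} ∪ CONV_{m^c} ∪ PERM_{m^c}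
∪ GRANK_{m^c} computes CLIQUE(m, ⌈m^δ⌉₊)`.

## The line (idea card `convex-collapse-feature-rank`, sharpened by the r1 triage panel)

LEVER: feasibility-form CONV gates collapse — `∧₂`, `∨₂`, CONV ∘ CONV and CONV gates reading
*foreign* (PERM/GRANK) wires homogenise into ONE CONV gate with additive width (Oliveira–Pudlák 2019,
Thm 4.3, in SDP-feasibility form; in tree for `{∧₂,∨₂} ∪ CONV` circuits:
`Summit.PneNP.PneNP.Theorems.circuit_collapse`). Hence every `B_s`-circuit has an
ALGEBRAIC-BUDGET NORMAL FORM (`stub_normalForm`): `t ≤ size` rounds, round `i` = ONE algebraic gate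
reading `≤ M` CONV super-gates over (raw edges ⊕ the `i` earlier algebraic outputs), and ONE top CONV
super-gate. ALTERNATION = `t`, the number of algebraic gates; all `∧/∨/CONV` structure is free.

INDUCTION ON `t` (the triage asked for the invariant, uniform in `t ≤ m^c` and immune to
threshold-computing PERM gates): Razborov's ONE-SIDED LEDGER, but at ROUND granularity and with CONV
itself as the approximator class. Referee pair: POSITIVES = bare `k`-cliques `cliqueVec K`,
`k = kSched m = ⌈m^{1/4}⌉` (δ = 1/4); NEGATIVES = `G(m, negP m)`, `negP m = 1 - 4 ln m / k` (dense,
`k`-clique-free whp). Invariant after `i` rounds: every algebraic feature `h j` (`j < i`) has a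
SUBSTITUTE `ĥ j ∈ CONV_V` over the RAW EDGES with `h j ≤ ĥ j` on all bare cliques outside a lost set
`BadZ` (`|BadZ| ≤ i ε C(m,k)`) and `ĥ j ≤ h j` on all negatives outside an event `BadG`
(`Pr ≤ i ε`). Step (`stub_algCompress`, the load-bearing stub): the round's CONV super-gates composed
with the substitutes are again CONV over raw edges (`stub_convCompose`, exact), so the round is ONE
algebraic gate over `≤ M` CONV functions of the raw edges, and such a function has a one-sided
`m^{-e}`-substitute in `CONV_{m^{c'}}` with `c'` INDEPENDENT of the input widths — errors are charged
against the TRUE gate applied to substituted children, so monotonicity alone propagates the invariant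
(a PERM gate that amplifies advantages costs nothing: advantage is never tracked). End: the top gate
composed with the substitutes is ONE CONV gate over raw edges accepting `≥ 3/4` of the bare cliques and,
off `BadG`, only negatives that contain a `k`-clique — contradicting APPROXIMATE SINGLE-CONV-GATE
BLINDNESS on the pair (`stub_convBlindApprox`, the distributional form of crux #2 `ConvexGateBlind` in
its collapsed single-gate form; attack = Farkas/“feature-rank”: a certified CONV gate over features is
the AND of the nonnegative feature-threshold inequalities of its certificate cone, and the margin
matrix `[w_G · φ(K) - θ_G]` has a psd factorisation of size `W` — Yannakakis/OP2019 Thm 7.4; LP data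
first, SDP data after re-realisation, cf. `Negative.UncertifiedRejection`).

Composition: `lowerBoundAt_kSched_of` (the four stub STATEMENTS as hypotheses → `LowerBoundAt kSched`)
is a real proof — normal form → induction over the rounds with the ledger → counting/union bound →
contradiction, with the polynomial width bookkeeping (`width_arith`) and `negP m ∈ [0,1]` eventually
(`negP_eventually`) proved here — and `CliqueExtLowerBound_of : CliqueExtLowerBound` applies it to the
four sorried stubs (skeleton audit shape: concludes the crux by name, sorries only in `stub_*`).

Disproof items honoured: width bounds `p+q ≤ s`, `d ≤ s` (every stub carries explicit polynomial
widths; §2, §7.4), size bound (t ≤ m^c rounds; §3), `k → ∞` and `m - k → ∞` (k = ⌈m^{1/4}⌉; §1),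
order `∀ c ∀ᶠ m` (every stub is `∀ c…, ∀ᶠ m`; §4), `B ≥ 0` (IsConvFn keeps it; §5); §8 (uncertified
SDP rejections) is why `stub_convBlindApprox`/`stub_algCompress` are stated SEMANTICALLY (for gate
functions), the certificate/feature-rank route being an attack, not a hypothesis.
-/

set_option linter.dupNamespace false

namespace Summit.PneNP.PneNP.Cruxes.CliqueExtLowerBound.ConvexCollapseFeatureRank

open Literature.Computability.Complexity Filter Finset
open Summit.PneNP.PneNP.Theorems.CliqueExtLowerBound.Negative (LowerBoundAt cliqueExtLowerBound_iff)

/-! ## Definitions -/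

/-- CONV gate FUNCTIONS on an arbitrary finite index type `κ`: the formula of `IsConvGate` with
`B : Fin p → κ → ℝ` (`B ≥ 0`), width `p + q ≤ W`. This is literally the shape produced by the in-tree
collapse theorem `Summit.PneNP.PneNP.Theorems.circuit_collapse`. [folklore] -/
def IsConvFn (W : ℕ) {κ : Type*} [Fintype κ] (f : (κ → Bool) → Bool) : Prop :=
  ∃ p q : ℕ, p + q ≤ W ∧ ∃ (A : Fin p → Matrix (Fin q) (Fin q) ℝ) (b : Fin p → ℝ)
    (B : Fin p → κ → ℝ), (∀ i e, 0 ≤ B i e) ∧ ∀ v : κ → Bool, f v = true ↔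
      ∃ Y : Matrix (Fin q) (Fin q) ℝ, Y.PosSemidef ∧
        ∀ i, (A i * Y).trace ≤ b i + ∑ e, B i e * (if v e then (1 : ℝ) else 0)

/-- ALGEBRAIC gates of budget `s`: `PERM_s ∪ GRANK_s`. [folklore] -/
def IsAlgGate (s : ℕ) (g : GateFn) : Prop := IsPermGate s g ∨ IsGRankGate s g

/-- The feature vector at level `i` of a feature sequence `h`: the raw inputs `x` and the first `i`
features `h 0 x, …, h (i-1) x`. [folklore] -/
def featVec {ι : Type*} (h : ℕ → (ι → Bool) → Bool) (i : ℕ) (x : ι → Bool) : ι ⊕ Fin i → Bool :=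
  Sum.elim x fun j => h j x

/-- Round `i` of an ALGEBRAIC-BUDGET NORMAL FORM: the feature `h i` is ONE algebraic gate `a` of budget
`s` whose argument positions read, through a wiring `w`, at most `M` distinct CONV super-gates `e j`
of width `≤ W` over the level-`i` feature vector. [folklore] -/
def IsAlgRound (s W M : ℕ) {ι : Type*} [Fintype ι] (h : ℕ → (ι → Bool) → Bool) (i : ℕ) : Prop :=
  ∃ a : GateFn, IsAlgGate s a ∧ ∃ (n : ℕ) (_ : n ≤ M) (e : Fin n → ((ι ⊕ Fin i → Bool) → Bool))
    (w : Fin a.1 → Fin n), (∀ j, IsConvFn W (e j)) ∧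
      ∀ x, h i x = a.2 (fun j => e (w j) (featVec h i x))

/-- `f` has an ALGEBRAIC-BUDGET NORMAL FORM with `≤ T` rounds: `f = cout ∘ featVec h t` with `cout`
ONE CONV super-gate of width `≤ W` and every round `i < t` as in `IsAlgRound s W M`. [folklore] -/
def HasAlgNormalForm (s W M T : ℕ) {ι : Type*} [Fintype ι] (f : (ι → Bool) → Bool) : Prop :=
  ∃ t : ℕ, t ≤ T ∧ ∃ h : ℕ → (ι → Bool) → Bool, (∀ i < t, IsAlgRound s W M h i) ∧
    ∃ cout : (ι ⊕ Fin t → Bool) → Bool, IsConvFn W cout ∧ ∀ x, f x = cout (featVec h t x)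

/-- Width of the CONV super-gates of the normal form of a size-`≤ S` circuit over `B_s` on `n` inputs:
the bound `4 (s'+1) (S+1) (n' + S + 2)` of `circuit_collapse` for the cut circuit (`s' = s + 1`
absorbs the identity gates standing in for the cut algebraic gates, `n' = n + S` inputs). [folklore] -/
def nfWidth (s S n : ℕ) : ℕ := 4 * (s + 2) * (S + 1) * (n + 2 * S + 2)

/-- The clique-size schedule of the line: `k = ⌈m^{1/4}⌉₊` (δ = 1/4 ∈ (0, 1/2)). [folklore] -/
noncomputable def kSched (m : ℕ) : ℕ := ⌈(m : ℝ) ^ (1 / 4 : ℝ)⌉₊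

/-- Edge probability of the NEGATIVE test distribution `G(m, 1 - 4 ln m / k)` (dense Erdős–Rényi,
`k`-clique-free with high probability). [folklore] -/
noncomputable def negP (m : ℕ) : ℝ := 1 - 4 * Real.log m / kSched m

/-- The bare `k`-cliques accepted by `g` but rejected by `f`: the positives LOST when `g` is replaced
by `f`. [folklore] -/
noncomputable def posLoss (m k : ℕ) (g f : (KEdge m → Bool) → Bool) : Finset (Finset (Fin m)) :=
  (powersetCard k (univ : Finset (Fin m))).filter fun K =>
    g (cliqueVec K) = true ∧ f (cliqueVec K) = false

/-- `f` is a ONE-SIDED `ε`-SUBSTITUTE for `g` on the referee pair (bare `k`-cliques / `G(m, negP m)`):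
`f` loses at most `ε·C(m,k)` of the cliques accepted by `g`, and has probability `≤ ε` of accepting a
negative rejected by `g`. Only these two directions are ever charged (Razborov's ledger). [folklore] -/
def OneSided (m k : ℕ) (ε : ℝ) (g f : (KEdge m → Bool) → Bool) : Prop :=
  ((posLoss m k g f).card : ℝ) ≤ ε * (m.choose k : ℝ) ∧
    prob (negP m) (fun G => f G = true ∧ g G = false) ≤ ε

/-! ## The registered stubs -/

/-- **stub_normalForm — algebraic-budget normal form (collapse through foreign wires).** Every
circuit with `≤ S` gates over `B_s = extGate s` on a finite input type `ι` computes a function with an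
algebraic-budget normal form: `≤ S` rounds (one per PERM/GRANK gate, in program order), CONV
super-gates of width `≤ nfWidth s S |ι|`, at most `|ι| + S` distinct super-gates per round. PROOF
ROUTE (provable now, M): cut the circuit at its algebraic gates — replace algebraic gate `j_i` by an
identity gate (`∈ CONV₁`) reading a fresh input `inr i` — to get, for each wire, a `{∧₂,∨₂} ∪
CONV_{s+1}` circuit on `ι ⊕ Fin i` with the same wire values (`CircuitSemantics`), and apply
`Summit.PneNP.PneNP.Theorems.circuit_collapse` to it; inputs and constant output wires are width-1
CONV gates. [cite: OliveiraPudlak2019, Thm 4.3] -/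
theorem stub_normalForm {ι : Type} [Fintype ι] [DecidableEq ι] (s S : ℕ) (C : Circuit ι)
    (hC : C.IsOver (extGate s)) (hS : C.size ≤ S) :
    HasAlgNormalForm s (nfWidth s S (Fintype.card ι)) (Fintype.card ι + S) S C.eval := by
  sorry

/-- **stub_convCompose — CONV is closed under composition with CONV features, width additive.** If
`c` is a CONV function of width `W` of (inputs ⊕ `i` feature slots) and each feature `f j` is a CONV
function of width `V` of the inputs, then `x ↦ c (x, f x)` is a CONV function of the inputs of width
`≤ W + i (V + 4(|ι|+2))`: homogenise the system of `f j` by a scalar `z_j ∈ [0,1]` (a `1×1` psd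
block), linearise `z_j·x_e` by `u_{j,e} ≤ z_j, u_{j,e} ≤ x_e`, feed `z` into the `B`-column of slot
`j` (`B ≥ 0` makes `z ≤ f(x)` sound; `z_j = f j x` is complete), pack block-diagonally. PROOF ROUTE
(provable now, S/M): the two-layer case of the in-tree `ConvCollapse.eval_of_levels` /
`exists_feasible` (`ConvexRankGatesConvexGateBlindCollapseSystem.lean`). [cite: OliveiraPudlak2019, Thm 4.3] -/
theorem stub_convCompose {ι : Type} [Fintype ι] [DecidableEq ι] {W V i : ℕ}
    (c : (ι ⊕ Fin i → Bool) → Bool) (hc : IsConvFn W c)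
    (f : Fin i → (ι → Bool) → Bool) (hf : ∀ j, IsConvFn V (f j)) :
    IsConvFn (W + i * (V + 4 * (Fintype.card ι + 2))) (fun x => c (Sum.elim x fun j => f j x)) := by
  sorry

/-- **stub_algCompress — the induction step on the algebraic budget (LOAD-BEARING, open).** For the
gate budget / fan-in exponent `c` and the error exponent `e` there is a substitute-width exponent `c'`
such that for EVERY input-width exponent `c''`, eventually in `m`: every algebraic gate
`a ∈ PERM_{m^c} ∪ GRANK_{m^c}` reading (through any wiring `w`) at most `m^c` CONV functions `d j` of
width `≤ m^{c''}` of the RAW EDGES has a one-sided `m^{-e}`-substitute `f ∈ CONV_{m^{c'}}` over the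
raw edges on the pair (bare `⌈m^{1/4}⌉`-cliques, `G(m, negP m)`). The exponent `c'` must not depend
on `c''` (that is what makes the induction over `≤ m^c` rounds close without width blow-up): on this
pair a polynomially-described gate is believed to see only bounded sub-cliques / edge statistics,
whatever the widths of its CONV inputs. Contains the single-gate content of crux #4 `LinAlgGateBlind`
in distributional form (take `d j` = the raw edges) and the interaction CONV → ALG. Why it might
fail: a PERM/GRANK gate of dimension `m^c` whose acceptance on bare cliques is witnessed only by
sub-cliques of size `≫ c + e` yet which rejects `G(m, 1 - 4 ln m/k)` with probability `≥ m^{-e}` —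
none known (cycle span programs / LP gates for `CLIQUE(m,r)` need width `≈ C(m,r)·m²`,
`Negative.PermSpanProgram`, `ExtMonotoneCliqueGate`; `grank_sees_every_clique`). [cite: Razborov1985; AlonBoppana1987; PitassiRobere2018] -/
theorem stub_algCompress (c e : ℕ) : ∃ c' : ℕ, ∀ c'' : ℕ, ∀ᶠ m : ℕ in atTop,
    ∀ a : GateFn, IsAlgGate (m ^ c) a → ∀ n ≤ m ^ c,
      ∀ (d : Fin n → (KEdge m → Bool) → Bool) (w : Fin a.1 → Fin n),
        (∀ j, IsConvFn (m ^ c'') (d j)) →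
          ∃ f : (KEdge m → Bool) → Bool, IsConvFn (m ^ c') f ∧
            OneSided m (kSched m) (1 / (m : ℝ) ^ e) (fun x => a.2 fun j => d (w j) x) f := by
  sorry

/-- **stub_convBlindApprox — approximate single-CONV-gate blindness on the referee pair (open; the
base `t = 0`).** For every width exponent `c`, eventually in `m`: a CONV function of width `≤ m^c` of
the raw edges that accepts at least `3/4` of the bare `⌈m^{1/4}⌉`-cliques accepts, with probability
`> 1/4`, a `⌈m^{1/4}⌉`-clique-FREE sample of `G(m, 1 - 4 ln m / k)`. This is the distributional form
of crux #2 `ConvexGateBlind` in its collapsed single-gate form (OP2019's open single-weak-gate problem,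
p. 3, in psd form) and includes "the negatives are clique-free whp" (first moment). Attack
(feature-rank): for LP / certified data the gate is the AND of the nonnegative edge-weight thresholds
`(Bᵀy, -bᵀy)` of its Farkas cone, so the margin matrix `[w_G(E(K)) - θ_G]_{G,K} ≥ 0` has a conic
(nonnegative / psd) factorisation of size `≤ m^c` (OP2019 Thm 7.4 / Yannakakis) while each certificate
`w_G` rejects only a `4 ln m / k` fraction of further negatives in expectation (Markov): a
psd-rank lower bound with a product measure on the negative side. Why it might fail: a poly psd-lift
of some up-closed convex body sandwiched between most clique vectors and most dense clique-free graphs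
(open even for LP lifts, OP2019 p. 3 / Thm 6.10; theta and low-degree SOS accept the negatives,
Coja-Oghlan 2005, Jones et al. 2022). [cite: OliveiraPudlak2019, p. 3 and Thm 7.4; Cojaoghlan2005; JonesEtAl2022] -/
theorem stub_convBlindApprox (c : ℕ) : ∀ᶠ m : ℕ in atTop,
    ∀ f : (KEdge m → Bool) → Bool, IsConvFn (m ^ c) f →
      (3 / 4 : ℝ) * (m.choose (kSched m) : ℝ) ≤
          (((powersetCard (kSched m) (univ : Finset (Fin m))).filter
            fun K => f (cliqueVec K) = true).card : ℝ) →
        (1 / 4 : ℝ) < prob (negP m) (fun G => f G = true ∧ cliqueFn m (kSched m) G = false) := by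
  sorry

/-! ## Proved glue: monotonicity, the round ledger, numerics -/

/-- The real indicator of a Boolean is monotone. [folklore] -/
theorem indicator_mono {a b : Bool} (h : a ≤ b) :
    (if a then (1 : ℝ) else 0) ≤ (if b then (1 : ℝ) else 0) := by
  cases a
  · cases b <;> simp
  · have hb : b = true := Bool.le_iff_imp.1 h rfl
    simp [hb]

/-- CONV functions are monotone (`B ≥ 0` only relaxes right-hand sides). [folklore] -/
theorem IsConvFn.monotone {W : ℕ} {κ : Type*} [Fintype κ] {f : (κ → Bool) → Bool}
    (hf : IsConvFn W f) : Monotone f := by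
  obtain ⟨p, q, -, A, b, B, hB, h⟩ := hf
  intro v w hvw
  apply Bool.le_iff_imp.2
  intro hv
  obtain ⟨Y, hY, hc⟩ := (h v).1 hv
  refine (h w).2 ⟨Y, hY, fun i => (hc i).trans ?_⟩
  exact add_le_add le_rfl (Finset.sum_le_sum fun e _ =>
    mul_le_mul_of_nonneg_left (indicator_mono (hvw e)) (hB i e))

/-- Width monotonicity of CONV functions. [folklore] -/
theorem IsConvFn.mono {W W' : ℕ} {κ : Type*} [Fintype κ] {f : (κ → Bool) → Bool}
    (hf : IsConvFn W f) (h : W ≤ W') : IsConvFn W' f := by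
  obtain ⟨p, q, hpq, rest⟩ := hf
  exact ⟨p, q, hpq.trans h, rest⟩

/-- Algebraic gates are monotone. [folklore] -/
theorem IsAlgGate.monotone {s : ℕ} {g : GateFn} (h : IsAlgGate s g) : Monotone g.2 :=
  h.elim (fun h => h.monotone) (fun h => h.monotone)

/-- Budget monotonicity of algebraic gates. [folklore] -/
theorem IsAlgGate.mono {s t : ℕ} {g : GateFn} (h : IsAlgGate s g) (hst : s ≤ t) : IsAlgGate t g :=
  h.elim (fun h => Or.inl (h.mono hst)) (fun h => Or.inr (h.mono hst))

/-- Comparing two feature extensions of the same input. [folklore] -/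
theorem sumElim_le {ι : Type*} {i : ℕ} (x : ι → Bool) {u u' : Fin i → Bool} (h : ∀ j, u j ≤ u' j) :
    Sum.elim x u ≤ Sum.elim x u' := by
  intro a
  rcases a with a | j
  · exact le_rfl
  · exact h j

section Ledger

variable {m k s W M T U V : ℕ} {ε : ℝ}

/-- **The round ledger** (the induction on the algebraic budget, for a fixed `m`). Given the step
(every algebraic gate of budget `s` over `≤ M` CONV_U functions of the raw edges has a one-sided
`ε`-substitute in CONV_V) and the composition closure (CONV_W super-gates over `≤ T` CONV_V features are
CONV_U over the raw edges), every prefix of `≤ t ≤ T` rounds of a normal form admits CONV_V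
substitutes for its features with `h j ≤ ĥ j` on the bare `k`-cliques outside a lost set of size
`≤ i ε C(m,k)` and `ĥ j ≤ h j` on the negatives outside an event of probability `≤ i ε`. [folklore] -/
theorem round_ledger (hp0 : 0 ≤ negP m) (hp1 : negP m ≤ 1)
    (hstep : ∀ a : GateFn, IsAlgGate s a → ∀ n ≤ M,
      ∀ (d : Fin n → (KEdge m → Bool) → Bool) (w : Fin a.1 → Fin n), (∀ j, IsConvFn U (d j)) →
        ∃ f : (KEdge m → Bool) → Bool, IsConvFn V f ∧
          OneSided m k ε (fun x => a.2 fun j => d (w j) x) f)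
    (hcomp : ∀ i ≤ T, ∀ c : (KEdge m ⊕ Fin i → Bool) → Bool, IsConvFn W c →
      ∀ f : Fin i → (KEdge m → Bool) → Bool, (∀ j, IsConvFn V (f j)) →
        IsConvFn U (fun x => c (Sum.elim x fun j => f j x)))
    (h : ℕ → (KEdge m → Bool) → Bool) {t : ℕ} (ht : t ≤ T)
    (hrounds : ∀ i < t, IsAlgRound s W M h i) :
    ∀ i ≤ t, ∃ (hh : ℕ → (KEdge m → Bool) → Bool) (BadZ : Finset (Finset (Fin m)))
      (BadG : (KEdge m → Bool) → Prop),
      (BadZ.card : ℝ) ≤ i * (ε * (m.choose k : ℝ)) ∧ prob (negP m) BadG ≤ i * ε ∧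
      (∀ j < i, IsConvFn V (hh j)) ∧
      (∀ j < i, ∀ K : Finset (Fin m), K.card = k → K ∉ BadZ →
        h j (cliqueVec K) = true → hh j (cliqueVec K) = true) ∧
      (∀ j < i, ∀ G : KEdge m → Bool, ¬ BadG G → hh j G = true → h j G = true) := by
  intro i
  induction i with
  | zero =>
    intro _
    refine ⟨fun _ _ => false, ∅, fun _ => False, by simp, ?_, ?_, ?_, ?_⟩
    · rw [prob_false]; simp
    · intro j hj; exact absurd hj (Nat.not_lt_zero j)
    · intro j hj; exact absurd hj (Nat.not_lt_zero j)
    · intro j hj; exact absurd hj (Nat.not_lt_zero j)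
  | succ i ih =>
    intro hi1
    have hit : i < t := hi1
    obtain ⟨hh, BadZ, BadG, hcard, hprob, hV, hpos, hneg⟩ := ih hit.le
    obtain ⟨a, ha, n, hn, e, w, he, hround⟩ := hrounds i hit
    -- the round's super-gates composed with the substitutes: CONV_U over the raw edges
    set d : Fin n → (KEdge m → Bool) → Bool := fun j x => e j (Sum.elim x fun j' : Fin i => hh j' x)
      with hd_def
    have hd : ∀ j, IsConvFn U (d j) := fun j =>
      hcomp i (hit.le.trans ht) (e j) (he j) (fun j' => hh j') fun j' => hV j' j'.2
    -- the step: a one-sided substitute for the whole round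
    obtain ⟨f, hfV, hfpos, hfneg⟩ := hstep a ha n hn d w hd
    set g : (KEdge m → Bool) → Bool := fun x => a.2 fun j => d (w j) x with hg_def
    refine ⟨fun j => if j = i then f else hh j, BadZ ∪ posLoss m k g f,
      fun G => BadG G ∨ (f G = true ∧ g G = false), ?_, ?_, ?_, ?_, ?_⟩
    · -- lost cliques
      calc ((BadZ ∪ posLoss m k g f).card : ℝ)
          ≤ (BadZ.card : ℝ) + ((posLoss m k g f).card : ℝ) := by
            exact_mod_cast Finset.card_union_le _ _
        _ ≤ i * (ε * (m.choose k : ℝ)) + ε * (m.choose k : ℝ) := add_le_add hcard hfpos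
        _ = ((i + 1 : ℕ) : ℝ) * (ε * (m.choose k : ℝ)) := by push_cast; ring
    · -- bad negatives
      calc prob (negP m) (fun G => BadG G ∨ (f G = true ∧ g G = false))
          ≤ prob (negP m) BadG + prob (negP m) (fun G => f G = true ∧ g G = false) :=
            prob_or_le hp0 hp1 _ _
        _ ≤ i * ε + ε := add_le_add hprob hfneg
        _ = ((i + 1 : ℕ) : ℝ) * ε := by push_cast; ring
    · -- substitutes are CONV_V
      intro j hj
      by_cases hji : j = i
      · simp only [hji, if_true]; exact hfV
      · simp only [hji, if_false]; exact hV j (by omega)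
    · -- positives: h j ≤ ĥ j on bare cliques outside the lost set
      intro j hj K hK hKbad hhj
      rw [Finset.notMem_union] at hKbad
      by_cases hji : j = i
      · subst hji
        simp only [if_true]
        -- the true round value is below the round applied to the substitutes
        have hle : featVec h j (cliqueVec K) ≤ Sum.elim (cliqueVec K) fun j' : Fin j => hh j' (cliqueVec K) :=
          sumElim_le _ fun j' => Bool.le_iff_imp.2 (hpos j' j'.2 K hK hKbad.1)
        have hg : g (cliqueVec K) = true := by
          have h1 : h j (cliqueVec K) ≤ g (cliqueVec K) := by
            rw [hround]
            exact ha.monotone fun jj => (he (w jj)).monotone hle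
          exact Bool.le_iff_imp.1 h1 hhj
        -- `K` was not lost at this round
        by_contra hf
        have hf' : f (cliqueVec K) = false := by simpa using hf
        exact hKbad.2 (Finset.mem_filter.2 ⟨Finset.mem_powersetCard.2 ⟨Finset.subset_univ _, hK⟩,
          hg, hf'⟩)
      · simp only [hji, if_false]
        exact hpos j (by omega) K hK hKbad.1 hhj
    · -- negatives: ĥ j ≤ h j outside the bad event
      intro j hj G hGbad hhj
      simp only [not_or, not_and] at hGbad
      by_cases hji : j = i
      · subst hji
        simp only [if_true] at hhj
        have hg : g G = true := by
          by_contra hgf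
          exact hGbad.2 hhj (by simpa using hgf)
        have hle : (Sum.elim G fun j' : Fin j => hh j' G) ≤ featVec h j G :=
          sumElim_le _ fun j' => Bool.le_iff_imp.2 (hneg j' j'.2 G hGbad.1)
        have h1 : g G ≤ h j G := by
          rw [hround]
          exact ha.monotone fun jj => (he (w jj)).monotone hle
        exact Bool.le_iff_imp.1 h1 hg
      · simp only [hji, if_false] at hhj
        exact hneg j (by omega) G hGbad.1 hhj

end Ledger

/-- `negP m ∈ [0,1]` eventually (`4 ln m ≤ m^{1/4} ≤ k` for large `m`). [folklore] -/
theorem negP_eventually : ∀ᶠ m : ℕ in atTop, 0 ≤ negP m ∧ negP m ≤ 1 := by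
  have h1 : ∀ᶠ x : ℝ in atTop, ‖Real.log x‖ ≤ (1 / 4) * ‖x ^ (1 / 4 : ℝ)‖ :=
    (isLittleO_log_rpow_atTop (by norm_num : (0 : ℝ) < 1 / 4)).def (by norm_num)
  have h2 : ∀ᶠ m : ℕ in atTop, ‖Real.log m‖ ≤ (1 / 4) * ‖(m : ℝ) ^ (1 / 4 : ℝ)‖ :=
    tendsto_natCast_atTop_atTop.eventually h1
  filter_upwards [h2, eventually_ge_atTop 1] with m hm h1m
  have hm1 : (1 : ℝ) ≤ m := by exact_mod_cast h1m
  have hlog : 0 ≤ Real.log m := Real.log_nonneg hm1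
  have hrpow : 0 < (m : ℝ) ^ (1 / 4 : ℝ) := Real.rpow_pos_of_pos (by linarith) _
  rw [Real.norm_eq_abs, Real.norm_eq_abs, abs_of_nonneg hlog, abs_of_nonneg hrpow.le] at hm
  have hk : (m : ℝ) ^ (1 / 4 : ℝ) ≤ (kSched m : ℝ) := Nat.le_ceil _
  have hkpos : (0 : ℝ) < kSched m := lt_of_lt_of_le hrpow hk
  unfold negP
  constructor
  · rw [sub_nonneg, div_le_one hkpos]
    linarith
  · rw [sub_le_self_iff]
    exact div_nonneg (by linarith) hkpos.le

/-- `|E(K_m)| ≤ m²`. [folklore] -/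
theorem card_KEdge_le (m : ℕ) : Fintype.card (KEdge m) ≤ m ^ 2 := by
  calc Fintype.card (KEdge m)
      ≤ Fintype.card (Sym2 (Fin m)) := Fintype.card_le_of_injective Subtype.val Subtype.val_injective
    _ ≤ Fintype.card (Fin m × Fin m) :=
        Fintype.card_le_of_surjective (Sym2.mk (α := Fin m)).uncurry Sym2.mk_surjective
    _ = m ^ 2 := by simp [sq]

/-- Polynomial width bookkeeping: the normal-form width plus `i ≤ m^c` composed substitutes of width
`m^{c'}` stays below `m^{3c + c' + 7}` (for `m ≥ 8`, `n ≤ m²` inputs). [folklore] -/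
theorem width_arith {m c c' i n : ℕ} (hm : 8 ≤ m) (hi : i ≤ m ^ c) (hn : n ≤ m ^ 2) :
    nfWidth (m ^ c) (m ^ c) n + i * (m ^ c' + 4 * (n + 2)) ≤ m ^ (3 * c + c' + 7) := by
  have hm1 : 1 ≤ m := by omega
  have hA : 1 ≤ m ^ c := Nat.one_le_pow _ _ (by omega)
  have hB : 1 ≤ m ^ c' := Nat.one_le_pow _ _ (by omega)
  have hm2 : 64 ≤ m ^ 2 := by nlinarith
  -- factor bounds
  have f1 : m ^ c + 2 ≤ m ^ (c + 1) := by rw [pow_succ]; nlinarith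
  have f2 : m ^ c + 1 ≤ m ^ (c + 1) := by rw [pow_succ]; nlinarith
  have f3 : n + 2 * m ^ c + 2 ≤ m ^ (c + 3) := by
    have e : m ^ (c + 3) = m ^ c * m ^ 2 * m := by ring
    have h1 : m ^ 2 ≤ m ^ c * m ^ 2 := Nat.le_mul_of_pos_left _ hA
    have h2 : m ^ c * 64 ≤ m ^ c * m ^ 2 := Nat.mul_le_mul_left _ hm2
    have h3 : m ^ c * m ^ 2 * 8 ≤ m ^ c * m ^ 2 * m := Nat.mul_le_mul_left _ hm
    rw [e]
    linarith
  have hW : nfWidth (m ^ c) (m ^ c) n ≤ m ^ (3 * c + 6) := by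
    unfold nfWidth
    calc 4 * (m ^ c + 2) * (m ^ c + 1) * (n + 2 * m ^ c + 2)
        ≤ m * m ^ (c + 1) * m ^ (c + 1) * m ^ (c + 3) := by
          have h4 : 4 ≤ m := by omega
          exact Nat.mul_le_mul (Nat.mul_le_mul (Nat.mul_le_mul h4 f1) f2) f3
      _ = m ^ (3 * c + 6) := by ring
  have f4 : m ^ c' + 4 * (n + 2) ≤ m ^ (c' + 4) := by
    have e : m ^ (c' + 4) = m ^ c' * m ^ 2 * m ^ 2 := by ring
    have h1 : m ^ 2 ≤ m ^ c' * m ^ 2 := Nat.le_mul_of_pos_left _ hB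
    have h2 : m ^ c' ≤ m ^ c' * m ^ 2 := Nat.le_mul_of_pos_right _ (by omega)
    have h3 : m ^ c' * m ^ 2 * 64 ≤ m ^ c' * m ^ 2 * m ^ 2 := Nat.mul_le_mul_left _ hm2
    rw [e]
    linarith
  have hI : i * (m ^ c' + 4 * (n + 2)) ≤ m ^ (c + c' + 4) := by
    calc i * (m ^ c' + 4 * (n + 2)) ≤ m ^ c * m ^ (c' + 4) := Nat.mul_le_mul hi f4
      _ = m ^ (c + c' + 4) := by ring
  have e1 : m ^ (3 * c + 6) ≤ m ^ (3 * c + c' + 6) := Nat.pow_le_pow_right hm1 (by omega)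
  have e2 : m ^ (c + c' + 4) ≤ m ^ (3 * c + c' + 6) := Nat.pow_le_pow_right hm1 (by omega)
  calc nfWidth (m ^ c) (m ^ c) n + i * (m ^ c' + 4 * (n + 2))
      ≤ m ^ (3 * c + c' + 6) + m ^ (3 * c + c' + 6) := add_le_add (hW.trans e1) (hI.trans e2)
    _ = 2 * m ^ (3 * c + c' + 6) := by ring
    _ ≤ m * m ^ (3 * c + c' + 6) := Nat.mul_le_mul_right _ (by omega)
    _ = m ^ (3 * c + c' + 7) := by ring

/-! ## The composition: the four stubs prove the crux -/

/-- **Composition, hypotheses form.** The statements of `stub_normalForm`, `stub_convCompose`,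
`stub_algCompress`, `stub_convBlindApprox` (copied literally as hypotheses) imply the crux in schedule
form `LowerBoundAt kSched` (δ = 1/4): normal form, the round ledger, counting and union bound,
contradiction with single-gate blindness. [folklore] -/
theorem lowerBoundAt_kSched_of
    (h_normalForm : ∀ {ι : Type} [Fintype ι] [DecidableEq ι] (s S : ℕ) (C : Circuit ι),
      C.IsOver (extGate s) → C.size ≤ S →
        HasAlgNormalForm s (nfWidth s S (Fintype.card ι)) (Fintype.card ι + S) S C.eval)
    (h_convCompose : ∀ {ι : Type} [Fintype ι] [DecidableEq ι] {W V i : ℕ}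
      (c : (ι ⊕ Fin i → Bool) → Bool), IsConvFn W c →
        ∀ f : Fin i → (ι → Bool) → Bool, (∀ j, IsConvFn V (f j)) →
          IsConvFn (W + i * (V + 4 * (Fintype.card ι + 2))) (fun x => c (Sum.elim x fun j => f j x)))
    (h_algCompress : ∀ c e : ℕ, ∃ c' : ℕ, ∀ c'' : ℕ, ∀ᶠ m : ℕ in atTop,
      ∀ a : GateFn, IsAlgGate (m ^ c) a → ∀ n ≤ m ^ c,
        ∀ (d : Fin n → (KEdge m → Bool) → Bool) (w : Fin a.1 → Fin n),
          (∀ j, IsConvFn (m ^ c'') (d j)) →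
            ∃ f : (KEdge m → Bool) → Bool, IsConvFn (m ^ c') f ∧
              OneSided m (kSched m) (1 / (m : ℝ) ^ e) (fun x => a.2 fun j => d (w j) x) f)
    (h_convBlindApprox : ∀ c : ℕ, ∀ᶠ m : ℕ in atTop,
      ∀ f : (KEdge m → Bool) → Bool, IsConvFn (m ^ c) f →
        (3 / 4 : ℝ) * (m.choose (kSched m) : ℝ) ≤
            (((powersetCard (kSched m) (univ : Finset (Fin m))).filter
              fun K => f (cliqueVec K) = true).card : ℝ) →
          (1 / 4 : ℝ) < prob (negP m) (fun G => f G = true ∧ cliqueFn m (kSched m) G = false)) :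
    LowerBoundAt kSched := by
  intro c
  -- exponents: budget/fan-in `c + 3`, error `c + 2`, substitutes `c'`, everything else `c''`
  obtain ⟨c', hc'⟩ := h_algCompress (c + 3) (c + 2)
  set c'' : ℕ := 3 * c + c' + 7 with hc''
  filter_upwards [hc' c'', h_convBlindApprox c'', eventually_ge_atTop 8, negP_eventually] with m hstep
    hblind hm8 hp C hC hsize hcomp
  obtain ⟨hp0, hp1⟩ := hp
  have hm1 : 1 ≤ m := by omega
  set k : ℕ := kSched m with hk
  set n : ℕ := Fintype.card (KEdge m) with hn
  have hn2 : n ≤ m ^ 2 := card_KEdge_le m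
  -- Step 1: algebraic-budget normal form
  obtain ⟨t, ht, h, hrounds, cout, hcout, heval⟩ := h_normalForm (m ^ c) (m ^ c) C hC hsize
  -- Step 2: instantiate the step and the composition closure at this `m`
  have hbudget : m ^ c ≤ m ^ (c + 3) := Nat.pow_le_pow_right hm1 (by omega)
  have hM : n + m ^ c ≤ m ^ (c + 3) := by
    have h1 : n ≤ m ^ (c + 2) := hn2.trans (Nat.pow_le_pow_right hm1 (by omega))
    have h2 : m ^ c ≤ m ^ (c + 2) := Nat.pow_le_pow_right hm1 (by omega)
    calc n + m ^ c ≤ m ^ (c + 2) + m ^ (c + 2) := add_le_add h1 h2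
      _ = 2 * m ^ (c + 2) := by ring
      _ ≤ m * m ^ (c + 2) := Nat.mul_le_mul_right _ (by omega)
      _ = m ^ (c + 3) := by ring
  have hstep' : ∀ a : GateFn, IsAlgGate (m ^ c) a → ∀ n' ≤ n + m ^ c,
      ∀ (d : Fin n' → (KEdge m → Bool) → Bool) (w : Fin a.1 → Fin n'),
        (∀ j, IsConvFn (m ^ c'') (d j)) →
          ∃ f : (KEdge m → Bool) → Bool, IsConvFn (m ^ c') f ∧
            OneSided m k (1 / (m : ℝ) ^ (c + 2)) (fun x => a.2 fun j => d (w j) x) f :=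
    fun a ha n' hn' d w hd => hstep a (ha.mono hbudget) n' (hn'.trans hM) d w hd
  have hcomp' : ∀ i ≤ m ^ c, ∀ c₀ : (KEdge m ⊕ Fin i → Bool) → Bool,
      IsConvFn (nfWidth (m ^ c) (m ^ c) n) c₀ →
        ∀ f : Fin i → (KEdge m → Bool) → Bool, (∀ j, IsConvFn (m ^ c') (f j)) →
          IsConvFn (m ^ c'') (fun x => c₀ (Sum.elim x fun j => f j x)) := by
    intro i hi c₀ hc₀ f hf
    exact (h_convCompose c₀ hc₀ f hf).mono (width_arith hm8 hi hn2)
  -- Step 3: the round ledger up to round `t`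
  obtain ⟨hh, BadZ, BadG, hcard, hprob, hV, hpos, hneg⟩ :=
    round_ledger hp0 hp1 hstep' hcomp' h ht hrounds t le_rfl
  -- error budget: `t ε ≤ 1/4`
  have hmR : (8 : ℝ) ≤ m := by exact_mod_cast hm8
  have htε : (t : ℝ) * (1 / (m : ℝ) ^ (c + 2)) ≤ 1 / 4 := by
    have htR : (t : ℝ) ≤ (m : ℝ) ^ c := by exact_mod_cast ht
    have hmc : (0 : ℝ) < (m : ℝ) ^ c := by positivity
    have hm2 : (64 : ℝ) ≤ (m : ℝ) ^ 2 := by nlinarith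
    rw [pow_add, mul_one_div]
    calc (t : ℝ) / ((m : ℝ) ^ c * (m : ℝ) ^ 2) ≤ (m : ℝ) ^ c / ((m : ℝ) ^ c * (m : ℝ) ^ 2) :=
          div_le_div_of_nonneg_right htR (by positivity)
      _ = 1 / (m : ℝ) ^ 2 := by field_simp
      _ ≤ 1 / 4 := by
          rw [div_le_div_iff₀ (by positivity) (by norm_num)]
          linarith
  have hchoose0 : (0 : ℝ) ≤ (m.choose k : ℝ) := Nat.cast_nonneg _
  have hcard' : (BadZ.card : ℝ) ≤ (1 / 4) * (m.choose k : ℝ) := by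
    calc (BadZ.card : ℝ) ≤ t * (1 / (m : ℝ) ^ (c + 2) * (m.choose k : ℝ)) := hcard
      _ = (t * (1 / (m : ℝ) ^ (c + 2))) * (m.choose k : ℝ) := by ring
      _ ≤ (1 / 4) * (m.choose k : ℝ) := mul_le_mul_of_nonneg_right htε hchoose0
  have hprob' : prob (negP m) BadG ≤ 1 / 4 := hprob.trans htε
  -- Step 4: the final single CONV gate over the raw edges
  set F : (KEdge m → Bool) → Bool := fun x => cout (Sum.elim x fun j : Fin t => hh j x) with hF
  have hFconv : IsConvFn (m ^ c'') F := hcomp' t ht cout hcout (fun j => hh j) fun j => hV j j.2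
  have hval : ∀ x, cliqueFn m k x = cout (featVec h t x) := fun x => (hcomp x).symm.trans (heval x)
  -- positives outside the lost set are accepted by `F`
  have hFpos : ∀ K : Finset (Fin m), K.card = k → K ∉ BadZ → F (cliqueVec K) = true := by
    intro K hK hKbad
    have hle : featVec h t (cliqueVec K) ≤ Sum.elim (cliqueVec K) fun j : Fin t => hh j (cliqueVec K) :=
      sumElim_le _ fun j => Bool.le_iff_imp.2 (hpos j j.2 K hK hKbad)
    have h1 : cliqueFn m k (cliqueVec K) ≤ F (cliqueVec K) := by
      rw [hval]; exact hcout.monotone hle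
    exact Bool.le_iff_imp.1 h1 (cliqueFn_cliqueVec hK.ge)
  -- negatives accepted by `F` outside the bad event contain a `k`-clique
  have hFneg : ∀ G : KEdge m → Bool, F G = true → cliqueFn m k G = false → BadG G := by
    intro G hFG hcl
    by_contra hGbad
    have hle : (Sum.elim G fun j : Fin t => hh j G) ≤ featVec h t G :=
      sumElim_le _ fun j => Bool.le_iff_imp.2 (hneg j j.2 G hGbad)
    have h1 : F G ≤ cliqueFn m k G := by
      rw [hval]; exact hcout.monotone hle
    have := Bool.le_iff_imp.1 h1 hFG
    rw [hcl] at this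
    exact Bool.false_ne_true this
  -- counting the accepted positives: at least `3/4` of all `k`-sets
  have hcount : (3 / 4 : ℝ) * (m.choose k : ℝ) ≤
      (((powersetCard k (univ : Finset (Fin m))).filter fun K => F (cliqueVec K) = true).card : ℝ) := by
    set PC := powersetCard k (univ : Finset (Fin m)) with hPC
    have hPCcard : PC.card = m.choose k := by
      rw [hPC, Finset.card_powersetCard, Finset.card_univ, Fintype.card_fin]
    have hsub : PC \ BadZ ⊆ PC.filter fun K => F (cliqueVec K) = true := by
      intro K hK
      rw [Finset.mem_sdiff] at hK
      exact Finset.mem_filter.2 ⟨hK.1, hFpos K (Finset.mem_powersetCard.1 hK.1).2 hK.2⟩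
    have h1 : PC.card ≤ (PC \ BadZ).card + BadZ.card := Finset.card_le_card_sdiff_add_card
    have h2 : (PC \ BadZ).card ≤ (PC.filter fun K => F (cliqueVec K) = true).card :=
      Finset.card_le_card hsub
    have h3 : (m.choose k : ℝ) ≤ ((PC.filter fun K => F (cliqueVec K) = true).card : ℝ) +
        (BadZ.card : ℝ) := by
      rw [← hPCcard]; exact_mod_cast h1.trans (Nat.add_le_add_right h2 _)
    linarith
  -- Step 5: contradiction with approximate single-gate blindness
  have hlt := hblind F hFconv hcount
  have hle : prob (negP m) (fun G => F G = true ∧ cliqueFn m k G = false) ≤ prob (negP m) BadG :=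
    prob_mono hp0 hp1 fun G hG => hFneg G hG.1 hG.2
  linarith

/-- **THE SKELETON: the four registered stubs prove the crux** (`δ = 1/4`; the only `sorry`s are inside
`stub_normalForm`, `stub_convCompose`, `stub_algCompress`, `stub_convBlindApprox`). [folklore] -/
theorem CliqueExtLowerBound_of : Summit.PneNP.PneNP.Theses.ConvexRankGates.CliqueExtLowerBound :=
  cliqueExtLowerBound_iff.2 ⟨1 / 4, by norm_num, by norm_num,
    lowerBoundAt_kSched_of stub_normalForm stub_convCompose stub_algCompress stub_convBlindApprox⟩

end Summit.PneNP.PneNP.Cruxes.CliqueExtLowerBound.ConvexCollapseFeatureRank
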